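import Summits.BirchSwinnertonDyer.BirchSwinnertonDyer.Theses.RamifiedSevenEllipticUnits
import Literature.NumberTheory.EllipticCurves.IsogenyNeronScalingMinimalDiscriminantDirectionProofs
import Literature.NumberTheory.EllipticCurves.QuadraticTwist
import Literature.NumberTheory.EllipticCurves.ThreeIsogenySelmerRatioTwistFamilies
import Mathlib.NumberTheory.Padics.PadicNumbers
import HarnessLib

set_option linter.dupNamespace false

/-!
# THEOREM L7 — the local condition at `7` of the `7`-isogeny descent on the type-III members of
# `𝒞₇` is TRIVIAL (`L₇ = 0`), certificate file; crux `EllipticUnitValueSevenOfGZK`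
# (stmt-BirchSwinnertonDyer-19945), crux idea `cuspidal-descent-kolyvagin-nonvanishing`;
# planner bsd-idea-20 g30

Companion memo: `CuspidalDescentLocalSeven-g30.md` (same crux directory). This file closes, on the
author side, the one transcription caveat carried by the support statement
`CuspidalDescent.K1.TheoremASelmerCounts` (file `CuspidalDescentK1Vocabulary.lean`, docstring:
"the local condition at `7` for `Sel^φ` (`L₇ = 0`) is the delicate input"): memo g25 §2 took
`L₇ = 0` from ROUTE-U numerics at `D = −11`; memo g30 PROVES it for every type-III member.

**THEOREM L7** (memo g30 §1). Let `E = W ≅ 49a1^{(D)}` (`D` squarefree, `7 ∤ D`), `φ : E → E'` a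
`ℚ`-isogeny of degree `7` (then `E' ≅ 49a3^{(D)}`), `ψ : E' → E` of degree `7` (`= ±φ̂`). Then over
`ℚ₇`: `#E'(ℚ₇)/φE(ℚ₇) = 1`, `#E(ℚ₇)[φ] = 1` (so the local condition of `Sel^φ(E/ℚ)` at `7` is the
ZERO subgroup of `H¹(ℚ₇, E[φ]) ≅ ℤ/7`), and `#E(ℚ₇)/ψE'(ℚ₇) = 7 = #H¹(ℚ₇, E'[ψ])`, `#E'(ℚ₇)[ψ] = 1`
(the local condition of `Sel^ψ(E'/ℚ)` at `7` is everything).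

Proof (memo §§2–3): (a) the Néron scaling `α = φ^*ω'/ω ∈ ℤ` is a `7`-adic UNIT, because
`ord₇ Δ_min` RISES from `3` (type III) to `9` (type III*) along `φ` — Gealy–Klagsbrun 2017 Thm. 1 /
Dokchitser–Dokchitser 2015 Table 1, in the tree as
`dvd_and_not_dvd_neronScaling_of_padicValInt_minimalDiscriminantInt_lt_of_relIndex_eq` (§2 below
applies it: KERNEL-CHECKED for the base pair `49a1 → 49a3` and in the abstract `3 → 9` form; a second,
tree-free proof by lattice covolumes is memo §2.2); dually `7 ∥ α_ψ`. (b) Schaefer's local formula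
`#coker φ(ℚ₇)/#ker φ(ℚ₇) = 7^{v₇(α)} · c₇(E')/c₇(E)` (Schaefer 1996 Lemma 3.8 = Dokchitser–Dokchitser
2015 Lemma 4.2; filtration proof in memo §3) with `c₇(III) = c₇(III*) = 2` (tree:
`localTamagawaNumber_eq_two_of_kodairaSymbolAt_eq_III_holds`, `…_IIIstar_holds`) and
`E(ℚ₇)[φ] = E'(ℚ₇)[ψ] = 0` (kernel characters `ω⁵χ_D`, `ω²χ_D` are ramified at `7`; the pair
`{ω², ω⁵}` is certified by `a₂(49a1) = 1 ≡ 2² + 2⁵ (mod 7)`, §0).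

Contents. §0 finite certificates (`c₄, c₆, Δ`, `7`-adic valuations, `j`, twist identities incl. the
ASYMMETRY `49a1^{(−7)} ≅ 49a3` with `u = 1` but `49a3^{(−7)} ≅ 49a1` only with `u = 7`, and the
partner pair `49a2 → 49a4` with the same valuation pattern); §1 `Δ_min(49a1) = −7³`,
`Δ_min(49a3) = −7⁹` (kernel-checked, global minimality of Cremona's models as instance hypotheses, the
tree's idiom); §2 THEOREM L7(a) kernel-checked from the tree; §3 THEOREM L7 typed over the tree's local
points map `Isogeny.pointHomOver ℚ_[7]` (statements only — paper-proved in the memo, NOT here).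
Self-contained: the K1 vocabulary file is a crux workfile, not a built library module, so its three
declarations used here (`c49a1`, `c49a3`, `IsTypeIII`) are restated VERBATIM in this namespace
(`c49a1`, `c49a3`, `IsTwistOf49a1`, `IsTypeIII` below unfold to the same terms as
`CuspidalDescent.K1.c49a1`, …). Nothing in this file is an instance, a named fact or a proposal; no
sorry. No summit statement, crux or route item is proved by this seat.

## References
* [GealyKlagsbrun2017] Thm. 1, Prop. 2.1, Cor. 3.2 (arXiv:1703.02148 pp. 3, 5–6).
* [DokchitserDokchitser2015LocalInvariants] Table 1, §4 Lemma 4.2 / Lemmas 10–12 (arXiv:1208.5519).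
* E. F. Schaefer, *Class groups and Selmer groups*, J. Number Theory 56 (1996) 79–114, Lemma 3.8.
* [MilneADT2006] I.7, proof of Thm. 7.3, p. 98 (the same local factor); [SilvermanAEC2009] IV.6.4,
  VII.2–VII.6, X.4; [SilvermanATAEC1994] IV.9 Table 4.1 (types III, III*: `c = 2`).
* [Cremona1997Algorithms] Table 1, `N = 49`.
-/

noncomputable section

open scoped Classical
open WeierstrassCurve

namespace Summit.BirchSwinnertonDyer.BirchSwinnertonDyer.Cruxes.EllipticUnitValueSevenOfGZK.CuspidalDescent.LocalSeven

open Literature.NumberTheory.EllipticCurves Literature.NumberTheory.EllipticCurves.ModularForms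

/-! ## §0 Finite certificates for the four conductor-`49` models -/

/-- Cremona `49a1 = [1, −1, 0, −2, −1]` = `X₀(49)` (`j = −3375`, `Δ = −7³`, CM by `ℤ[(1+√−7)/2]`);
verbatim the K1 file's `CuspidalDescent.K1.c49a1`. [cite: Cremona1997Algorithms, Table 1, N = 49] -/
def c49a1 : WeierstrassCurve ℚ := ⟨1, -1, 0, -2, -1⟩

/-- Cremona `49a3 = [1, −1, 0, −107, 552] ≅ 49a1^{(−7)}` (`Δ = −7⁹`), the target of the rational
`7`-isogeny from `49a1`; verbatim `CuspidalDescent.K1.c49a3`. [cite: Cremona1997Algorithms, Table 1, N = 49] -/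
def c49a3 : WeierstrassCurve ℚ := ⟨1, -1, 0, -107, 552⟩

/-- `W ≅_ℚ 49a1^{(D)}` (a `VariableChange ℚ` carries the tree's twist model to `W`); verbatim
`CuspidalDescent.K1.IsTwistOf49a1`. [folklore] -/
def IsTwistOf49a1 (W : WeierstrassCurve ℚ) (D : ℤ) : Prop :=
  ∃ v : VariableChange ℚ, v • c49a1.quadraticTwist (D : ℚ) = W

/-- Type-III presentation `W ≅ 49a1^{(D)}`, `D` squarefree, `7 ∤ D`; verbatim
`CuspidalDescent.K1.IsTypeIII`. [folklore] -/
def IsTypeIII (W : WeierstrassCurve ℚ) (D : ℤ) : Prop :=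
  Squarefree D ∧ ¬ (7 : ℤ) ∣ D ∧ IsTwistOf49a1 W D

/-- Cremona `49a2 = [1, −1, 0, −37, −78]` (`j = 16581375 = 255³`, `Δ = 7³`): the `j ≠ −3375` members of
`𝒞₇` are its twists; source of the second `7`-isogeny `49a2 → 49a4`. [cite: Cremona1997Algorithms, Table 1, N = 49] -/
def c49a2 : WeierstrassCurve ℚ := ⟨1, -1, 0, -37, -78⟩

/-- Cremona `49a4 = [1, −1, 0, −1822, 30393]` (`j = 16581375`, `Δ = 7⁹`) `≅ 49a2^{(−7)}`. [cite: Cremona1997Algorithms, Table 1, N = 49] -/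
def c49a4 : WeierstrassCurve ℚ := ⟨1, -1, 0, -1822, 30393⟩

/-- `(c₄, c₆, Δ)(49a1) = (105, 1323, −343) = (3·5·7, 3³·7², −7³)`: valuation triple `(1, 2, 3)` at `7`
— Tate's algorithm (`p ≥ 5`): type III, `c₇ = 2`. [cite: Cremona1997Algorithms, Table 1, N = 49] -/
theorem c49a1_invariants : c49a1.c₄ = 105 ∧ c49a1.c₆ = 1323 ∧ c49a1.Δ = -343 := by
  refine ⟨?_, ?_, ?_⟩ <;>
  norm_num [c49a1, WeierstrassCurve.c₄, WeierstrassCurve.c₆, WeierstrassCurve.Δ,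
    WeierstrassCurve.b₂, WeierstrassCurve.b₄, WeierstrassCurve.b₆, WeierstrassCurve.b₈]

/-- `(c₄, c₆, Δ)(49a3) = (5145, −453789, −40353607) = (3·5·7³, −3³·7⁵, −7⁹)`: valuation triple
`(3, 5, 9)` at `7` — type III*, `c₇ = 2`. [cite: Cremona1997Algorithms, Table 1, N = 49] -/
theorem c49a3_invariants : c49a3.c₄ = 5145 ∧ c49a3.c₆ = -453789 ∧ c49a3.Δ = -40353607 := by
  refine ⟨?_, ?_, ?_⟩ <;>
  norm_num [c49a3, WeierstrassCurve.c₄, WeierstrassCurve.c₆, WeierstrassCurve.Δ,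
    WeierstrassCurve.b₂, WeierstrassCurve.b₄, WeierstrassCurve.b₆, WeierstrassCurve.b₈]

/-- `(c₄, c₆, Δ)(49a2) = (1785, 75411, 343) = (3·5·7·17, 3⁴·7²·19, 7³)`: triple `(1, 2, 3)`, type III.
[cite: Cremona1997Algorithms, Table 1, N = 49] -/
theorem c49a2_invariants : c49a2.c₄ = 1785 ∧ c49a2.c₆ = 75411 ∧ c49a2.Δ = 343 := by
  refine ⟨?_, ?_, ?_⟩ <;>
  norm_num [c49a2, WeierstrassCurve.c₄, WeierstrassCurve.c₆, WeierstrassCurve.Δ,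
    WeierstrassCurve.b₂, WeierstrassCurve.b₄, WeierstrassCurve.b₆, WeierstrassCurve.b₈]

/-- `(c₄, c₆, Δ)(49a4) = (87465, −25865973, 40353607) = (7²·1785, −7³·75411, 7⁹)`: triple `(3, 5, 9)`,
type III*. [cite: Cremona1997Algorithms, Table 1, N = 49] -/
theorem c49a4_invariants : c49a4.c₄ = 87465 ∧ c49a4.c₆ = -25865973 ∧ c49a4.Δ = 40353607 := by
  refine ⟨?_, ?_, ?_⟩ <;>
  norm_num [c49a4, WeierstrassCurve.c₄, WeierstrassCurve.c₆, WeierstrassCurve.Δ,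
    WeierstrassCurve.b₂, WeierstrassCurve.b₄, WeierstrassCurve.b₆, WeierstrassCurve.b₈]

/-- The `7`-adic valuation triples: `(v₇ c₄, v₇ c₆, v₇ Δ) = (1, 2, 3)` for `49a1`, `49a2` and
`(3, 5, 9)` for `49a3`, `49a4` (as valuations of the natural numbers `|c₄|, |c₆|, |Δ|`). For `p ≥ 5`
these triples ARE Tate's algorithm: `v(Δ) = 3 < 12` with `v(j) = 0` is type III, `v(Δ) = 9` is type
III*, both with Tamagawa number `2`. [cite: SilvermanATAEC1994, IV.9 Table 4.1] -/
theorem seven_adic_triples :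
    (padicValNat 7 105 = 1 ∧ padicValNat 7 1323 = 2 ∧ padicValNat 7 343 = 3) ∧
    (padicValNat 7 5145 = 3 ∧ padicValNat 7 453789 = 5 ∧ padicValNat 7 40353607 = 9) ∧
    (padicValNat 7 1785 = 1 ∧ padicValNat 7 75411 = 2) ∧
    (padicValNat 7 87465 = 3 ∧ padicValNat 7 25865973 = 5) := by
  have h7 : Nat.Prime 7 := by norm_num
  haveI : Fact (Nat.Prime 7) := ⟨h7⟩
  have key : ∀ (k m : ℕ), ¬ 7 ∣ m → padicValNat 7 (7 ^ k * m) = k := fun k m hm ↦ by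
    have hm0 : m ≠ 0 := by rintro rfl; exact hm (dvd_zero 7)
    rw [padicValNat.mul (pow_ne_zero _ h7.ne_zero) hm0, padicValNat.prime_pow,
      padicValNat.eq_zero_of_not_dvd hm, add_zero]
  refine ⟨⟨?_, ?_, ?_⟩, ⟨?_, ?_, ?_⟩, ⟨?_, ?_⟩, ⟨?_, ?_⟩⟩
  · simpa using key 1 15 (by norm_num)
  · simpa using key 2 27 (by norm_num)
  · simpa using key 3 1 (by norm_num)
  · simpa using key 3 15 (by norm_num)
  · simpa using key 5 27 (by norm_num)
  · simpa using key 9 1 (by norm_num)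
  · simpa using key 1 255 (by norm_num)
  · simpa using key 2 1539 (by norm_num)
  · simpa using key 3 255 (by norm_num)
  · simpa using key 5 1539 (by norm_num)

/-- `j(49a1) = j(49a3) = −3375 = −15³` and `j(49a2) = j(49a4) = 16581375 = 255³` (`7 ∤ j`: potentially
GOOD reduction at `7` on both sides of each `7`-isogeny; the two sides of each isogeny are twists of
each other by `−7`). [cite: Cremona1997Algorithms, Table 1, N = 49] -/
theorem j_values [c49a1.IsElliptic] [c49a3.IsElliptic] [c49a2.IsElliptic] [c49a4.IsElliptic] :
    c49a1.j = -3375 ∧ c49a3.j = -3375 ∧ c49a2.j = 16581375 ∧ c49a4.j = 16581375 := by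
  refine ⟨?_, ?_, ?_, ?_⟩
  · rw [j, Units.inv_mul_eq_iff_eq_mul, coe_Δ', c49a1_invariants.2.2]
    norm_num [c49a1, WeierstrassCurve.c₄, WeierstrassCurve.b₂, WeierstrassCurve.b₄]
  · rw [j, Units.inv_mul_eq_iff_eq_mul, coe_Δ', c49a3_invariants.2.2]
    norm_num [c49a3, WeierstrassCurve.c₄, WeierstrassCurve.b₂, WeierstrassCurve.b₄]
  · rw [j, Units.inv_mul_eq_iff_eq_mul, coe_Δ', c49a2_invariants.2.2]
    norm_num [c49a2, WeierstrassCurve.c₄, WeierstrassCurve.b₂, WeierstrassCurve.b₄]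
  · rw [j, Units.inv_mul_eq_iff_eq_mul, coe_Δ', c49a4_invariants.2.2]
    norm_num [c49a4, WeierstrassCurve.c₄, WeierstrassCurve.b₂, WeierstrassCurve.b₄]

/-- **Frobenius certificate for the kernel characters.** `#Ẽ(𝔽₂) = 2` for `49a1` (affine points of
`y² + xy = x³ + x² + 1` over `𝔽₂`: only `(0, 1)`), so `a₂(49a1) = 1`; the semisimplification of
`E[7]` is `ω^k ⊕ ω^{1−k}` (good outside `7`, `det = ω`) with `2^k + 2^{1−k} ≡ a₂ = 1 (mod 7)`, which
holds EXACTLY for `k ∈ {2, 5}`: the kernel characters of `φ`, `φ̂` are `{ω², ω⁵}` (twisted by `χ_D` on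
`E_D`), both RAMIFIED at `7` (orders `3`, `6` on inertia) — hence `E_D(ℚ₇)[φ] = E'_D(ℚ₇)[φ̂] = 0`.
The `decide` below checks the congruence table `k ↦ 2^k + 2^{(7−k) mod 6… }`: precisely, for
`k < 6`, `(2^k + 2^{(7 − k) % 6}) % 7 = 1 ↔ k = 2 ∨ k = 5` (`2^{1−k} = 2^{(7−k) mod 6}` in `𝔽₇ˣ`).
[cite: SilvermanAEC2009, V.2 (trace of Frobenius) with III.8 (Weil pairing, det ρ̄ = ω)] -/
theorem kernel_character_exponents :
    (∀ k < 6, (2 ^ k + 2 ^ ((7 - k) % 6)) % 7 = 1 ↔ (k = 2 ∨ k = 5)) ∧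
    -- the point count of `49a1 mod 2`: the affine solutions of `y² + xy = x³ + x² + 1` over `𝔽₂`
    (∀ x y : ZMod 2, (y ^ 2 + x * y = x ^ 3 + x ^ 2 + 1) ↔ (x = 0 ∧ y = 1)) := by
  refine ⟨by decide, by decide⟩

/-- **Twist certificates.** (i) `49a1.quadraticTwist(−7) = [0, 21/4, 0, −98, 343]` is carried to
`49a3` by `(u, r, s, t) = (1, −2, 1/2, 0)` (the K1 file's `isTwistOf49a1_c49a3`; `u = 1`: the raw
twist model is already `7`-minimal, `Δ = (−7)⁶·(−7³) = −7⁹`; re-checked here); (ii) in the REVERSE direction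
`49a3.quadraticTwist(−7) = [0, 21/4, 0, −5243, −189336]` has `Δ = (−7)⁶·(−7⁹) = −7¹⁵`, NOT minimal at
`7`, and is carried to `49a1` only by `u = 7`: `(u, r, s, t) = (7, −14, 7/2, 0)`. This asymmetry is the
model-level shadow of THEOREM L7(a): `φ : 49a1 → 49a3` is étale on Néron differentials (`α = ±1`)
while `φ̂` is not (`α' = ±7`). [cite: Cremona1997Algorithms, Table 1, N = 49] -/
theorem reverse_twist_certificate :
    (IsTwistOf49a1 c49a3 (-7) ∧ (c49a1.quadraticTwist (-7)).Δ = -(7 : ℚ) ^ 9) ∧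
    (c49a3.quadraticTwist (-7)).Δ = -(7 : ℚ) ^ 15 ∧
    (⟨Units.mk0 (7 : ℚ) (by norm_num), -14, 7 / 2, 0⟩ : VariableChange ℚ) •
        c49a3.quadraticTwist (-7) = c49a1 := by
  refine ⟨⟨⟨⟨1, -2, 1 / 2, 0⟩, ?_⟩, ?_⟩, ?_, ?_⟩
  · ext <;> norm_num [WeierstrassCurve.variableChange_a₁, WeierstrassCurve.variableChange_a₂,
      WeierstrassCurve.variableChange_a₃, WeierstrassCurve.variableChange_a₄,
      WeierstrassCurve.variableChange_a₆, WeierstrassCurve.quadraticTwist, c49a1, c49a3,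
      WeierstrassCurve.b₂, WeierstrassCurve.b₄, WeierstrassCurve.b₆]
  · rw [WeierstrassCurve.quadraticTwist_Δ, c49a1_invariants.2.2]; norm_num
  · rw [WeierstrassCurve.quadraticTwist_Δ, c49a3_invariants.2.2]; norm_num
  · ext <;> norm_num [WeierstrassCurve.variableChange_a₁, WeierstrassCurve.variableChange_a₂,
      WeierstrassCurve.variableChange_a₃, WeierstrassCurve.variableChange_a₄,
      WeierstrassCurve.variableChange_a₆, WeierstrassCurve.quadraticTwist, c49a1, c49a3,
      WeierstrassCurve.b₂, WeierstrassCurve.b₄, WeierstrassCurve.b₆, Units.val_inv_eq_inv_val]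

/-- `49a4 ≅ 49a2^{(−7)}`: `(1, −2, 1/2, 0) • 49a2.quadraticTwist(−7) = 49a4` (`u = 1`, as for
`49a1 → 49a3`). [cite: Cremona1997Algorithms, Table 1, N = 49] -/
theorem c49a4_eq_twist_c49a2 :
    (⟨1, -2, 1 / 2, 0⟩ : VariableChange ℚ) • c49a2.quadraticTwist (-7) = c49a4 := by
  ext <;> norm_num [WeierstrassCurve.variableChange_a₁, WeierstrassCurve.variableChange_a₂,
    WeierstrassCurve.variableChange_a₃, WeierstrassCurve.variableChange_a₄,
    WeierstrassCurve.variableChange_a₆, WeierstrassCurve.quadraticTwist, c49a2, c49a4,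
    WeierstrassCurve.b₂, WeierstrassCurve.b₄, WeierstrassCurve.b₆]

/-- **The whole twist family at once.** For every `D`: `Δ(49a1^{(D)}) = −7³·D⁶` and
`Δ(49a3^{(D)}) = −7⁹·D⁶` (tree `quadraticTwist_Δ`); for `7 ∤ D` squarefree these raw twist models are
minimal at `7` (valuations `3`, `9 < 12`), so `ord₇ Δ_min(E_D) = 3 < 9 = ord₇ Δ_min(E'_D)` on every
type-III member: the RISE hypothesis of §2 holds uniformly in `D`. [folklore] -/
theorem twist_family_Δ (D : ℚ) :
    (c49a1.quadraticTwist D).Δ = -(7 : ℚ) ^ 3 * D ^ 6 ∧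
    (c49a3.quadraticTwist D).Δ = -(7 : ℚ) ^ 9 * D ^ 6 := by
  refine ⟨?_, ?_⟩
  · rw [WeierstrassCurve.quadraticTwist_Δ, c49a1_invariants.2.2]; ring
  · rw [WeierstrassCurve.quadraticTwist_Δ, c49a3_invariants.2.2]; ring

/-! ## §1 Minimal discriminants of the base pair (kernel-checked; global minimality of Cremona's
models enters as an instance hypothesis, the tree's idiom — cf. `AECExampleX410Torsion.lean`) -/

/-- The integral model of `49a1` is Cremona's `[1, −1, 0, −2, −1]`. [cite: Cremona1997Algorithms, Table 1, N = 49] -/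
theorem integralModelInt_c49a1 [c49a1.IsGloballyMinimal] :
    integralModelInt c49a1 = ⟨1, -1, 0, -2, -1⟩ := by
  apply WeierstrassCurve.map_injective (f := Int.castRingHom ℚ) Int.cast_injective
  simp only [map_integralModelInt]
  ext <;> simp [c49a1]

/-- The integral model of `49a3` is Cremona's `[1, −1, 0, −107, 552]`. [cite: Cremona1997Algorithms, Table 1, N = 49] -/
theorem integralModelInt_c49a3 [c49a3.IsGloballyMinimal] :
    integralModelInt c49a3 = ⟨1, -1, 0, -107, 552⟩ := by
  apply WeierstrassCurve.map_injective (f := Int.castRingHom ℚ) Int.cast_injective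
  simp only [map_integralModelInt]
  ext <;> simp [c49a3]

/-- `Δ_min(49a1) = −343 = −7³`. [cite: Cremona1997Algorithms, Table 1, N = 49] -/
theorem minimalDiscriminantInt_c49a1 [c49a1.IsGloballyMinimal] :
    minimalDiscriminantInt c49a1 = -343 := by
  rw [minimalDiscriminantInt, integralModelInt_c49a1]
  norm_num [WeierstrassCurve.Δ, WeierstrassCurve.b₂, WeierstrassCurve.b₄, WeierstrassCurve.b₆,
    WeierstrassCurve.b₈]

/-- `Δ_min(49a3) = −40353607 = −7⁹`. [cite: Cremona1997Algorithms, Table 1, N = 49] -/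
theorem minimalDiscriminantInt_c49a3 [c49a3.IsGloballyMinimal] :
    minimalDiscriminantInt c49a3 = -40353607 := by
  rw [minimalDiscriminantInt, integralModelInt_c49a3]
  norm_num [WeierstrassCurve.Δ, WeierstrassCurve.b₂, WeierstrassCurve.b₄, WeierstrassCurve.b₆,
    WeierstrassCurve.b₈]

/-- `ord₇ Δ_min(49a1) = 3` and `ord₇ Δ_min(49a3) = 9`: the RISE `3 < 9` along `φ : 49a1 → 49a3`.
[cite: Cremona1997Algorithms, Table 1, N = 49] -/
theorem padicValInt_minimalDiscriminantInt_pair [c49a1.IsGloballyMinimal] [c49a3.IsGloballyMinimal] :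
    padicValInt 7 (minimalDiscriminantInt c49a1) = 3 ∧
    padicValInt 7 (minimalDiscriminantInt c49a3) = 9 := by
  haveI : Fact (Nat.Prime 7) := ⟨by norm_num⟩
  rw [minimalDiscriminantInt_c49a1, minimalDiscriminantInt_c49a3, padicValInt, padicValInt]
  refine ⟨?_, ?_⟩
  · rw [show (-343 : ℤ).natAbs = 7 ^ 3 by rfl, padicValNat.prime_pow]
  · rw [show (-40353607 : ℤ).natAbs = 7 ^ 9 by rfl, padicValNat.prime_pow]

/-- `ord₇ j(49a1) = ord₇ j(49a3) = 0 ≥ 0` (`j = −3375 = −3³·5³`): potentially good reduction at `7`,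
the standing hypothesis of the direction theorem. [cite: Cremona1997Algorithms, Table 1, N = 49] -/
theorem padicValRat_j_pair [c49a1.IsElliptic] [c49a3.IsElliptic] [c49a2.IsElliptic]
    [c49a4.IsElliptic] : padicValRat 7 c49a1.j = 0 ∧ padicValRat 7 c49a3.j = 0 := by
  have hj := j_values
  have h0 : padicValRat 7 (-3375 : ℚ) = 0 := by
    rw [show (-3375 : ℚ) = ((-3375 : ℤ) : ℚ) by norm_num, padicValRat.of_int, padicValInt,
      show (-3375 : ℤ).natAbs = 3375 by rfl, padicValNat.eq_zero_of_not_dvd (by norm_num)]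
    rfl
  exact ⟨by rw [hj.1, h0], by rw [hj.2.1, h0]⟩

/-! ## §2 THEOREM L7 (a), kernel-checked: a `7`-isogeny along a rise `ord₇ Δ_min : 3 → 9` is étale
on Néron differentials (`7 ∤ α`), and its dual is not (`7 ∥ α'`) -/

/-- **THEOREM L7 (a), abstract form.** `W, W'/ℚ` globally minimal elliptic curves, `W` potentially
good at `7`, `ord₇ Δ_min(W) = 3`, `ord₇ Δ_min(W') = 9` (every type-III member `E_D ≅ 49a1^{(D)}` and
its partner `E'_D ≅ 49a3^{(D)}`, `7 ∤ D`, by `twist_family_Δ`); `L, L'` their Néron period pairs and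
`α ∈ ℤ` with `αΛ_W ⊆ Λ_{W'}` of index `7` (so `z ↦ αz` is a `7`-isogeny `W → W'` pulling the Néron
differential of `W'` back to `α·ω_W`). Then `7 ∤ α`: the isogeny induces an ISOMORPHISM of formal
groups `Ŵ(7ℤ₇) ≅ Ŵ'(7ℤ₇)` (`log' ∘ φ = α · log`). One line from the tree's rise clause
(Gealy–Klagsbrun 2017 Thm. 1 / Dokchitser–Dokchitser 2015 Table 1).
[cite: GealyKlagsbrun2017, Thm. 1 via Prop. 2.1 and Cor. 3.2 (arXiv:1703.02148 pp. 3, 5–6)]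
[cite: DokchitserDokchitser2015LocalInvariants, Table 1 rows l = p (arXiv:1208.5519 p. 3)] -/
theorem not_seven_dvd_neronScaling_of_rise (W W' : WeierstrassCurve ℚ) [W.IsElliptic]
    [W'.IsElliptic] [W.IsGloballyMinimal] [W'.IsGloballyMinimal]
    (hj : 0 ≤ padicValRat 7 W.j) (hδ : padicValInt 7 W.minimalDiscriminantInt = 3)
    (hδ' : padicValInt 7 W'.minimalDiscriminantInt = 9) (L L' : PeriodPair) (α : ℤ)
    (hL : IsNeronLatticeOf (W.baseChange ℂ) L) (hL' : IsNeronLatticeOf (W'.baseChange ℂ) L')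
    (hα : ∀ z ∈ L.lattice, (α : ℂ) * z ∈ L'.lattice)
    (hidx : (L.lattice.toAddSubgroup.map (AddMonoidHom.mulLeft (α : ℂ))).relIndex
      L'.lattice.toAddSubgroup = 7) :
    ¬ (7 : ℤ) ∣ α := by
  haveI : Fact (Nat.Prime 7) := ⟨by norm_num⟩
  exact (dvd_and_not_dvd_neronScaling_of_padicValInt_minimalDiscriminantInt_lt_of_relIndex_eq W W'
    7 L L' α hL hL' hα hidx hj).2 (by rw [hδ, hδ']; norm_num)

/-- **THEOREM L7 (a), dual form.** Same setting read from the III* side: `ord₇ Δ_min(W) = 9`,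
`ord₇ Δ_min(W') = 3`, `β ∈ ℤ` with `βΛ_W ⊆ Λ_{W'}` of index `7` (the dual isogeny `ψ = φ̂ : E' → E`).
Then `7 ∥ β`: on formal groups `ψ` is multiplication by a uniformiser, `#coker = 7`.
[cite: GealyKlagsbrun2017, Thm. 1 via Prop. 2.1 and Cor. 3.2 (arXiv:1703.02148 pp. 3, 5–6)] -/
theorem seven_dvd_neronScaling_of_drop (W W' : WeierstrassCurve ℚ) [W.IsElliptic]
    [W'.IsElliptic] [W.IsGloballyMinimal] [W'.IsGloballyMinimal]
    (hj : 0 ≤ padicValRat 7 W.j) (hδ : padicValInt 7 W.minimalDiscriminantInt = 9)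
    (hδ' : padicValInt 7 W'.minimalDiscriminantInt = 3) (L L' : PeriodPair) (β : ℤ)
    (hL : IsNeronLatticeOf (W.baseChange ℂ) L) (hL' : IsNeronLatticeOf (W'.baseChange ℂ) L')
    (hβ : ∀ z ∈ L.lattice, (β : ℂ) * z ∈ L'.lattice)
    (hidx : (L.lattice.toAddSubgroup.map (AddMonoidHom.mulLeft (β : ℂ))).relIndex
      L'.lattice.toAddSubgroup = 7) :
    (7 : ℤ) ∣ β ∧ ¬ (7 : ℤ) ^ 2 ∣ β := by
  haveI : Fact (Nat.Prime 7) := ⟨by norm_num⟩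
  exact (dvd_and_not_dvd_neronScaling_of_padicValInt_minimalDiscriminantInt_lt_of_relIndex_eq W W'
    7 L L' β hL hL' hβ hidx hj).1 (by rw [hδ, hδ']; norm_num)

/-- **THEOREM L7 (a) for the base pair `49a1 → 49a3`** (`D = 1`; Cremona's models globally minimal —
instance hypotheses): any analytic `7`-isogeny scalar `α` from the Néron lattice of `49a1` into that of
`49a3` is prime to `7`, and any scalar `β` the other way is exactly divisible by `7`.
[cite: GealyKlagsbrun2017, Thm. 1 (arXiv:1703.02148 p. 3)] [cite: Cremona1997Algorithms, Table 1, N = 49] -/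
theorem neronScaling_c49a1_c49a3 [c49a1.IsElliptic] [c49a3.IsElliptic] [c49a2.IsElliptic]
    [c49a4.IsElliptic] [c49a1.IsGloballyMinimal] [c49a3.IsGloballyMinimal] (L L' : PeriodPair)
    (hL : IsNeronLatticeOf (c49a1.baseChange ℂ) L) (hL' : IsNeronLatticeOf (c49a3.baseChange ℂ) L') :
    (∀ α : ℤ, (∀ z ∈ L.lattice, (α : ℂ) * z ∈ L'.lattice) →
      (L.lattice.toAddSubgroup.map (AddMonoidHom.mulLeft (α : ℂ))).relIndex
        L'.lattice.toAddSubgroup = 7 → ¬ (7 : ℤ) ∣ α) ∧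
    (∀ β : ℤ, (∀ z ∈ L'.lattice, (β : ℂ) * z ∈ L.lattice) →
      (L'.lattice.toAddSubgroup.map (AddMonoidHom.mulLeft (β : ℂ))).relIndex
        L.lattice.toAddSubgroup = 7 → (7 : ℤ) ∣ β ∧ ¬ (7 : ℤ) ^ 2 ∣ β) := by
  obtain ⟨h3, h9⟩ := padicValInt_minimalDiscriminantInt_pair
  obtain ⟨hj1, hj3⟩ := padicValRat_j_pair
  exact ⟨fun α hα hidx ↦ not_seven_dvd_neronScaling_of_rise c49a1 c49a3 hj1.ge h3 h9 L L' α hL hL'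
      hα hidx,
    fun β hβ hidx ↦ seven_dvd_neronScaling_of_drop c49a3 c49a1 hj3.ge h9 h3 L' L β hL' hL hβ hidx⟩

/-! ## §3 THEOREM L7, typed over the tree's local points map at `ℚ₇` (statements; paper-proved in
memo g30 §3 from §2 + Schaefer's Lemma 3.8 — NOT proved in this file) -/

/-- **THEOREM L7 — `L₇ = 0` for `Sel^φ` on every type-III member (paper-proved, memo g30).** For
`E = W ≅ 49a1^{(D)}` (`D` squarefree, `7 ∤ D`: `IsTypeIII`) and every `ℚ`-isogeny `φ : E → E'` of
degree `7`: over `ℚ₇`, `φ` is SURJECTIVE on points and injective, `#E'(ℚ₇)/φE(ℚ₇) = 1 = #E(ℚ₇)[φ]`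
(tree vocabulary: `Isogeny.pointHomOver ℚ_[7]`, so `φ.localSelmerRatio ℚ_[7] = 1`). Hence the image
of the local Kummer map `E'(ℚ₇)/φE(ℚ₇) ↪ H¹(ℚ₇, E[φ])` is `0`: the local condition of `Sel^φ(E/ℚ)` at
`7` is the zero class, as used in Theorem A (memo g25 §2, `TheoremASelmerCounts`). Proof: §2
(`7 ∤ α`) + Schaefer's formula `#coker/#ker = 7^{v₇(α)}·c₇(E')/c₇(E) = 1·2/2` + `E(ℚ₇)[φ] = 0`
(`kernel_character_exponents`). Why it might fail (as a transcription only): a wrong Tamagawa ratio —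
excluded, `c(III) = c(III*) = 2` unconditionally. [cite: SilvermanAEC2009, X.4 (Thm. X.4.2)] -/
def LocalImageAtSevenTrivial : Prop :=
  ∀ (W W' : WeierstrassCurve ℚ) [W.IsElliptic] [W'.IsElliptic] [Fact (Nat.Prime 7)],
    (∃ D : ℤ, IsTypeIII W D) → ∀ φ : Isogeny W W', φ.degree = 7 →
      Nat.card ((W'.baseChange ℚ_[7]).toAffine.Point ⧸ (φ.pointHomOver ℚ_[7]).range) = 1 ∧
        Nat.card (φ.pointHomOver ℚ_[7]).ker = 1

/-- **THEOREM L7, dual side — `L'₇ =` everything for `Sel^ψ` (paper-proved, memo g30).** Same `E = W`;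
for every `ℚ`-isogeny `ψ : E' → E` of degree `7` INTO `E` (`ψ = ±φ̂`, `E' ≅ 49a3^{(D)}`):
`#E(ℚ₇)/ψE'(ℚ₇) = 7` and `#E'(ℚ₇)[ψ] = 1` (`ψ.localSelmerRatio ℚ_[7] = 7`); since
`#H¹(ℚ₇, E'[ψ]) = 7` (local Euler characteristic, `H⁰ = H² = 0` for the ramified character `ω²χ_D`),
the local condition of `Sel^ψ(E'/ℚ)` at `7` is all of `H¹(ℚ₇, E'[ψ])`. Proof: §2 dual form
(`7 ∥ β`) + Schaefer's formula `7^{1}·2/2`. [cite: SilvermanAEC2009, X.4 (Thm. X.4.2)] -/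
def DualLocalCokernelAtSevenCardSeven : Prop :=
  ∀ (W W' : WeierstrassCurve ℚ) [W.IsElliptic] [W'.IsElliptic] [Fact (Nat.Prime 7)],
    (∃ D : ℤ, IsTypeIII W D) → ∀ ψ : Isogeny W' W, ψ.degree = 7 →
      Nat.card ((W.baseChange ℚ_[7]).toAffine.Point ⧸ (ψ.pointHomOver ℚ_[7]).range) = 7 ∧
        Nat.card (ψ.pointHomOver ℚ_[7]).ker = 1

/-- Bookkeeping: the crux this certificate serves, by name (elaboration check only). The support
statement whose caveat THEOREM L7 discharges is `CuspidalDescent.K1.TheoremASelmerCounts` of the K1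
workfile (unchanged; it remains paper-proved). -/
example : Prop :=
  Summit.BirchSwinnertonDyer.BirchSwinnertonDyer.Theses.RamifiedSevenEllipticUnits.EllipticUnitValueSevenOfGZK ∧
    LocalImageAtSevenTrivial ∧ DualLocalCokernelAtSevenCardSeven

end Summit.BirchSwinnertonDyer.BirchSwinnertonDyer.Cruxes.EllipticUnitValueSevenOfGZK.CuspidalDescent.LocalSeven

end
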